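import Summits.Ventures.YMGap.Thresholds.LatticeBakryEmeryDuality
import HarnessLib

/-!
# Venture YMGap — static exponential clustering, Part I-a:
# the weighted carré du champ on `SU(N)^E`, the weighted Bochner identity and the weighted Ricci term

HONEST FRAMING: venture file (cell `pub-ymgap`, track (a), seat lit-1). Calculus towards a STATIC
(semigroup-free) proof of Shen–Zhu–Zhu's mass-gap step with the Hessian constant as a parameter
(the Literature named fact `shenZhuZhu_massGap_transfer`, CMP 400 (2023) Cor. 4.11): the printed proof
(arXiv:2204.12737v1 §4.3, p. 28–30) runs the Langevin semigroup `P_t`; here the decay of correlations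
is to be obtained from the Bakry–Émery structure by a Witten-Laplacian / Combes–Thomas type energy
estimate (method of B. Helffer, J. Funct. Anal. 155 (1998) 571–586, and J. Sjöstrand, there for
convex Hamiltonians on `ℝ^Λ` with full elliptic regularity), implemented on top of the multi-link
Bakry–Émery calculus `LatticeBakryEmery*` (seat p2). No physics and no number in this file.

For link weights `w : E → ℝ` (later `w_e = exp(2c·dist(e, Λ_g))`) we introduce the **weighted carré
du champ** `Γ^w(F,G) = ∑_{(e,α)} w_e D_{(e,α)}F D_{(e,α)}G` and the weighted iterated carré du champ
`Γ₂^w(u) = ½ L_S Γ^w(u,u) - Γ^w(u, L_S u)` and prove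

* `Gam2W_eq` — the weighted Bochner identity
  `Γ₂^w(u) = ∑_{ab} w_a (D_bD_au)² - ∑_{ab} w_a D_au D_bu D_aD_bS` (the commutator term still
  vanishes: the weights are constant on each link and the block structure constants are diagonal);
* `ricci_GamW_le` — the weighted Ricci bound `(N/2) Γ^w(u,u) ≤ ∑_{ab} w_a (D_bD_au)²`
  (`Ric_{SU(N)} = N/2` link by link, Shen–Zhu–Zhu (4.8)).

Parts I-b/I-c (`SharpClusteringBochner`, `SharpClusteringEnergy`): the weighted curvature bound and
the weighted energy estimate.

## References

* H. Shen, R. Zhu, X. Zhu, CMP 400 (2023) 805–851 = arXiv:2204.12737v1, Lemma 4.1, (4.7)–(4.8),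
  Cor. 4.11.
* B. Helffer, J. Funct. Anal. 155 (1998) 571–586 (method).
* D. Bakry, I. Gentil, M. Ledoux, Grundlehren 348 (2014), §1.16 (Γ₂ formalism).
* Venture files `LatticeBakryEmery{Calculus,Frame,Bochner,Integration,Duality}.lean` (seat p2).
-/

noncomputable section

open scoped Matrix ComplexConjugate BigOperators Matrix.Norms.Frobenius ContDiff Topology
open Matrix Complex Finset MeasureTheory
open Literature.MathematicalPhysics.QuantumFieldTheory
open Literature.MathematicalPhysics.QuantumFieldTheory.SUNBakryEmery
  (FrameIdx frame frame_conjTranspose frame_trace frameGrad frameGrad_conjTranspose frameGrad_trace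
   frobNorm_frameGrad_sq conjTranspose_comm_of_skew trace_comm)

namespace Summit.Ventures.YMGap

namespace SharpClustering

open LatticeBakryEmery

universe u

variable {ι : Type u} [Fintype ι] [DecidableEq ι] {N : ℕ}

section Calculus


/-! ### The weighted carré du champ -/

/-- The **weighted carré du champ** `Γ^w(F,G)(Q) = ∑_{(e,α)} w_e D_{(e,α)}F(Q) D_{(e,α)}G(Q)
= ∑_e w_e ⟨∇_eF, ∇_eG⟩` for link weights `w : E → ℝ`. -/
def GamW (w : ι → ℝ) (F G : Cfg ι N → ℝ) : Cfg ι N → ℝ :=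
  fun Q => ∑ a : BIdx ι N, w a.1 * (algD (bframe a) F Q * algD (bframe a) G Q)

/-- The **weighted iterated carré du champ** `Γ₂^w(u) = ½ L_S Γ^w(u,u) - Γ^w(u, L_S u)`. -/
def Gam2W (w : ι → ℝ) (S u : Cfg ι N → ℝ) (Q : Cfg ι N) : ℝ :=
  (1 / 2) * genL S (GamW w u u) Q - GamW w u (genL S u) Q

/-- `Γ^w` is symmetric. -/
theorem GamW_comm (w : ι → ℝ) (F G : Cfg ι N → ℝ) : GamW w F G = GamW w G F := by
  funext Q
  simp only [GamW, mul_comm (algD _ F Q)]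

/-- `Γ^w(F,F) = ∑_a w_a (D_aF)²`. -/
theorem GamW_self_eq_sum_sq (w : ι → ℝ) (F : Cfg ι N → ℝ) (Q : Cfg ι N) :
    GamW w F F Q = ∑ a : BIdx ι N, w a.1 * algD (bframe a) F Q ^ 2 := by
  simp only [GamW, sq]

/-- `Γ^w(F,F) ≥ 0` for nonnegative weights. -/
theorem GamW_self_nonneg {w : ι → ℝ} (hw : ∀ e, 0 ≤ w e) (F : Cfg ι N → ℝ) (Q : Cfg ι N) :
    0 ≤ GamW w F F Q := by
  rw [GamW_self_eq_sum_sq]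
  exact sum_nonneg fun a _ => mul_nonneg (hw a.1) (sq_nonneg _)

/-- With unit weights `Γ^w = Γ`. -/
theorem GamW_one (F G : Cfg ι N → ℝ) : GamW (fun _ : ι => (1 : ℝ)) F G = Gam F G := by
  funext Q
  simp only [GamW, Gam, one_mul]

/-- **Cauchy–Schwarz for `Γ^w`** (nonnegative weights): `|Γ^w(F,G)| ≤ √Γ^w(F,F) √Γ^w(G,G)`. -/
theorem abs_GamW_le {w : ι → ℝ} (hw : ∀ e, 0 ≤ w e) (F G : Cfg ι N → ℝ) (Q : Cfg ι N) :
    |GamW w F G Q| ≤ Real.sqrt (GamW w F F Q) * Real.sqrt (GamW w G G Q) := by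
  have hGFG : GamW w F G Q = ∑ a : BIdx ι N,
      (Real.sqrt (w a.1) * algD (bframe a) F Q) * (Real.sqrt (w a.1) * algD (bframe a) G Q) := by
    simp only [GamW]
    refine sum_congr rfl fun a _ => ?_
    have := Real.mul_self_sqrt (hw a.1)
    linear_combination (-(algD (bframe a) F Q * algD (bframe a) G Q)) * this
  have hFF : GamW w F F Q = ∑ a : BIdx ι N, (Real.sqrt (w a.1) * algD (bframe a) F Q) ^ 2 := by
    rw [GamW_self_eq_sum_sq]
    refine sum_congr rfl fun a _ => ?_
    rw [mul_pow, Real.sq_sqrt (hw a.1)]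
  have hGG : GamW w G G Q = ∑ a : BIdx ι N, (Real.sqrt (w a.1) * algD (bframe a) G Q) ^ 2 := by
    rw [GamW_self_eq_sum_sq]
    refine sum_congr rfl fun a _ => ?_
    rw [mul_pow, Real.sq_sqrt (hw a.1)]
  rw [hGFG, hFF, hGG]
  have h := Real.sum_mul_le_sqrt_mul_sqrt univ (fun a : BIdx ι N => Real.sqrt (w a.1) * algD (bframe a) F Q)
    (fun a => Real.sqrt (w a.1) * algD (bframe a) G Q)
  have h' := Real.sum_mul_le_sqrt_mul_sqrt univ (fun a : BIdx ι N => -(Real.sqrt (w a.1) * algD (bframe a) F Q))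
    (fun a => Real.sqrt (w a.1) * algD (bframe a) G Q)
  simp only [neg_mul, sum_neg_distrib, neg_sq] at h'
  exact abs_le.2 ⟨by linarith, h⟩

/-- `Γ^w(F,G)` is smooth. -/
theorem contDiff_GamW (w : ι → ℝ) {F G : Cfg ι N → ℝ} (hF : ContDiff ℝ ∞ F) (hG : ContDiff ℝ ∞ G) :
    ContDiff ℝ ∞ (GamW w F G) :=
  ContDiff.sum fun _ _ => contDiff_const.mul ((contDiff_algD hF _).mul (contDiff_algD hG _))

/-- `Γ₂^w` is smooth in `Q`. -/
theorem contDiff_Gam2W (w : ι → ℝ) {S u : Cfg ι N → ℝ} (hS : ContDiff ℝ ∞ S) (hu : ContDiff ℝ ∞ u) :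
    ContDiff ℝ ∞ (Gam2W w S u) := by
  have : Gam2W w S u = fun Q => (1 / 2) * genL S (GamW w u u) Q - GamW w u (genL S u) Q := rfl
  rw [this]
  exact (contDiff_const.mul (contDiff_genL hS (contDiff_GamW w hu hu))).sub
    (contDiff_GamW w hu (contDiff_genL hS hu))

/-! ### The weighted Bochner identity -/

/-- `D_B Γ^w(u,u) = ∑_a 2 w_a D_au · D_B D_au`. -/
theorem algD_GamW_self (w : ι → ℝ) {u : Cfg ι N → ℝ} (hu : ContDiff ℝ ∞ u) (B : Cfg ι N) (Q : Cfg ι N) :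
    algD B (GamW w u u) Q =
      ∑ a : BIdx ι N, 2 * w a.1 * algD (bframe a) u Q * algD B (algD (bframe a) u) Q := by
  have : GamW w u u = fun Q => ∑ a : BIdx ι N, w a.1 * (algD (bframe a) u Q * algD (bframe a) u Q) := rfl
  rw [this, algD_sum univ (F := fun a Q => w a.1 * (algD (bframe a) u Q * algD (bframe a) u Q))
    (fun a _ => contDiff_const.mul ((contDiff_algD hu _).mul (contDiff_algD hu _)))]
  refine sum_congr rfl fun a _ => ?_
  rw [algD_const_mul ((contDiff_algD hu _).mul (contDiff_algD hu _))]
  simp only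
  rw [algD_fun_mul (contDiff_algD hu _) (contDiff_algD hu _)]
  ring

/-- `Δ Γ^w(u,u) = 2 ∑_{b,a} w_a (D_bD_au)² + 2 ∑_a w_a D_au · D_aΔu` (using `[Δ, D_a] = 0`). -/
theorem Lap_GamW_self (hN : N ≠ 0) (w : ι → ℝ) {u : Cfg ι N → ℝ} (hu : ContDiff ℝ ∞ u) (Q : Cfg ι N) :
    Lap (GamW w u u) Q =
      2 * ∑ b : BIdx ι N, ∑ a : BIdx ι N, w a.1 * algD (bframe b) (algD (bframe a) u) Q ^ 2 +
      2 * ∑ a : BIdx ι N, w a.1 * (algD (bframe a) u Q * algD (bframe a) (Lap u) Q) := by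
  have h1 : ∀ b : BIdx ι N, algD (bframe b) (algD (bframe b) (GamW w u u)) Q =
      ∑ a, 2 * w a.1 * (algD (bframe b) (algD (bframe a) u) Q ^ 2 +
        algD (bframe a) u Q * algD (bframe b) (algD (bframe b) (algD (bframe a) u)) Q) := by
    intro b
    have hfun : algD (bframe b) (GamW w u u) =
        fun Q => ∑ a, (2 * w a.1) * (algD (bframe a) u Q * algD (bframe b) (algD (bframe a) u) Q) := by
      funext Q
      rw [algD_GamW_self w hu]
      exact sum_congr rfl fun a _ => by ring
    rw [hfun, algD_sum univ (F := fun a Q => (2 * w a.1) * (algD (bframe a) u Q * algD (bframe b) (algD (bframe a) u) Q))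
      (fun a _ => contDiff_const.mul ((contDiff_algD hu _).mul (contDiff_algD (contDiff_algD hu _) _)))]
    refine sum_congr rfl fun a _ => ?_
    rw [algD_const_mul ((contDiff_algD hu _).mul (contDiff_algD (contDiff_algD hu _) _)),
      algD_fun_mul (contDiff_algD hu _) (contDiff_algD (contDiff_algD hu _) _)]
    ring
  rw [show Lap (GamW w u u) Q = ∑ b : BIdx ι N, algD (bframe b) (algD (bframe b) (GamW w u u)) Q from rfl]
  simp_rw [h1]
  have h2 : ∀ b : BIdx ι N, ∑ a : BIdx ι N, 2 * w a.1 * (algD (bframe b) (algD (bframe a) u) Q ^ 2 +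
      algD (bframe a) u Q * algD (bframe b) (algD (bframe b) (algD (bframe a) u)) Q) =
      2 * ∑ a : BIdx ι N, w a.1 * algD (bframe b) (algD (bframe a) u) Q ^ 2 +
        ∑ a : BIdx ι N, 2 * w a.1 * (algD (bframe a) u Q * algD (bframe b) (algD (bframe b) (algD (bframe a) u)) Q) := by
    intro b
    rw [mul_sum, ← sum_add_distrib]
    exact sum_congr rfl fun a _ => by ring
  simp_rw [h2]
  rw [sum_add_distrib, ← mul_sum]
  congr 1
  rw [sum_comm, mul_sum]
  refine sum_congr rfl fun a _ => ?_
  rw [← sum_algD_algD_algD_eq_algD_Lap hN hu a Q, mul_sum, mul_sum, mul_sum]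
  exact sum_congr rfl fun b _ => by ring

/-- `Γ^w(u, L_Su) = ∑_a w_a D_au D_aΔu + ∑_{ab} w_a D_au (D_aD_bS · D_bu + D_bS · D_aD_bu)`. -/
theorem GamW_genL (w : ι → ℝ) {S u : Cfg ι N → ℝ} (hS : ContDiff ℝ ∞ S) (hu : ContDiff ℝ ∞ u) (Q : Cfg ι N) :
    GamW w u (genL S u) Q = ∑ a : BIdx ι N, w a.1 * (algD (bframe a) u Q * algD (bframe a) (Lap u) Q) +
      ∑ a : BIdx ι N, ∑ b : BIdx ι N, w a.1 * (algD (bframe a) u Q *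
        (algD (bframe a) (algD (bframe b) S) Q * algD (bframe b) u Q +
          algD (bframe b) S Q * algD (bframe a) (algD (bframe b) u) Q)) := by
  have hgen : genL S u = Lap u + Gam S u := by funext Q; rfl
  have hGam : ∀ a : BIdx ι N, algD (bframe a) (Gam S u) Q =
      ∑ b, (algD (bframe a) (algD (bframe b) S) Q * algD (bframe b) u Q +
        algD (bframe b) S Q * algD (bframe a) (algD (bframe b) u) Q) := by
    intro a
    have hfun : Gam S u = fun Q => ∑ b : BIdx ι N, algD (bframe b) S Q * algD (bframe b) u Q := rfl
    rw [hfun, algD_sum univ (F := fun b Q => algD (bframe b) S Q * algD (bframe b) u Q)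
      (fun b _ => (contDiff_algD hS _).mul (contDiff_algD hu _))]
    refine sum_congr rfl fun b _ => ?_
    rw [algD_fun_mul (contDiff_algD hS _) (contDiff_algD hu _)]
    ring
  rw [GamW, ← sum_add_distrib]
  refine sum_congr rfl fun a _ => ?_
  rw [hgen, algD_add (contDiff_Lap hu) (contDiff_Gam hS hu), Pi.add_apply, hGam, mul_add, mul_add, mul_sum,
    mul_sum]

omit [Fintype ι] in
/-- The block structure constants are diagonal in the link: `c_{bac} ≠ 0 → b.1 = a.1`. -/
theorem bstrC_eq_zero_of_ne {a b c : BIdx ι N} (h : b.1 ≠ a.1) : bstrC b a c = 0 := by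
  unfold bstrC
  rw [if_neg (fun hh => h hh.1)]

/-- **Weighted Bochner identity**:
`Γ₂^w(u) = ∑_{a,b} w_a (D_bD_au)² - ∑_{a,b} w_a D_au D_bu D_aD_bS`. The weights are constant on each
link and the block structure constants vanish across links, so the commutator term drops out exactly
as in the unweighted formula `LatticeBakryEmery.Gam2_eq`. -/
theorem Gam2W_eq (hN : N ≠ 0) (w : ι → ℝ) {S u : Cfg ι N → ℝ} (hS : ContDiff ℝ ∞ S) (hu : ContDiff ℝ ∞ u)
    (Q : Cfg ι N) :
    Gam2W w S u Q = ∑ a : BIdx ι N, ∑ b : BIdx ι N, w a.1 * algD (bframe b) (algD (bframe a) u) Q ^ 2 -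
      ∑ a : BIdx ι N, ∑ b : BIdx ι N,
        w a.1 * (algD (bframe a) u Q * algD (bframe b) u Q * algD (bframe a) (algD (bframe b) S) Q) := by
  -- the commutator term vanishes
  have hcomm : ∑ a : BIdx ι N, ∑ b : BIdx ι N, w a.1 * (algD (bframe b) S Q * algD (bframe a) u Q *
      (algD (bframe b) (algD (bframe a) u) Q - algD (bframe a) (algD (bframe b) u) Q)) = 0 := by
    have h1 : ∀ a b : BIdx ι N, algD (bframe b) (algD (bframe a) u) Q - algD (bframe a) (algD (bframe b) u) Q =
        ∑ c, bstrC b a c * algD (bframe c) u Q := fun a b => algD_algD_sub_eq_sum_bstrC hN hu b a Q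
    -- replace `w a.1` by `w b.1` (the structure constants are diagonal in the link)
    have h2 : ∀ a b : BIdx ι N, w a.1 * (algD (bframe b) S Q * algD (bframe a) u Q *
        (algD (bframe b) (algD (bframe a) u) Q - algD (bframe a) (algD (bframe b) u) Q)) =
        algD (bframe b) S Q * w b.1 * ∑ c, bstrC b a c * (algD (bframe a) u Q * algD (bframe c) u Q) := by
      intro a b
      rw [h1, mul_sum, mul_sum, mul_sum]
      refine sum_congr rfl fun c _ => ?_
      by_cases hba : b.1 = a.1
      · rw [hba]; ring
      · rw [bstrC_eq_zero_of_ne hba]; ring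
    simp_rw [h2]
    rw [sum_comm]
    refine sum_eq_zero fun b _ => ?_
    rw [← mul_sum, LatticeBakryEmery.sum_sum_eq_zero_of_antisymm (fun a c => bstrC_swap23 b a c)
      (fun a c => mul_comm _ _), mul_zero]
  have eC : Gam S (GamW w u u) Q =
      2 * ∑ b : BIdx ι N, ∑ a : BIdx ι N,
        w a.1 * (algD (bframe b) S Q * algD (bframe a) u Q * algD (bframe b) (algD (bframe a) u) Q) := by
    show ∑ b, algD (bframe b) S Q * algD (bframe b) (GamW w u u) Q = _
    simp_rw [algD_GamW_self w hu, mul_sum]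
    refine sum_congr rfl fun b _ => sum_congr rfl fun a _ => ?_
    ring
  have eSwap : ∑ b : BIdx ι N, ∑ a : BIdx ι N,
      w a.1 * (algD (bframe b) S Q * algD (bframe a) u Q * algD (bframe b) (algD (bframe a) u) Q) =
      ∑ a : BIdx ι N, ∑ b : BIdx ι N,
        w a.1 * (algD (bframe b) S Q * algD (bframe a) u Q * algD (bframe a) (algD (bframe b) u) Q) := by
    rw [sum_comm]
    have h0 : ∑ a : BIdx ι N, ∑ b : BIdx ι N,
        w a.1 * (algD (bframe b) S Q * algD (bframe a) u Q * algD (bframe b) (algD (bframe a) u) Q) -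
        ∑ a : BIdx ι N, ∑ b : BIdx ι N,
          w a.1 * (algD (bframe b) S Q * algD (bframe a) u Q * algD (bframe a) (algD (bframe b) u) Q) = 0 := by
      rw [← sum_sub_distrib]
      simp_rw [← sum_sub_distrib]
      rw [← hcomm]
      refine sum_congr rfl fun a _ => sum_congr rfl fun b _ => ?_
      ring
    linarith
  have eB : ∑ a : BIdx ι N, ∑ b : BIdx ι N, w a.1 * (algD (bframe a) u Q *
        (algD (bframe a) (algD (bframe b) S) Q * algD (bframe b) u Q +
          algD (bframe b) S Q * algD (bframe a) (algD (bframe b) u) Q)) =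
      ∑ a : BIdx ι N, ∑ b : BIdx ι N,
        w a.1 * (algD (bframe a) u Q * algD (bframe b) u Q * algD (bframe a) (algD (bframe b) S) Q) +
        ∑ a : BIdx ι N, ∑ b : BIdx ι N,
          w a.1 * (algD (bframe b) S Q * algD (bframe a) u Q * algD (bframe a) (algD (bframe b) u) Q) := by
    rw [← sum_add_distrib]
    refine sum_congr rfl fun a _ => ?_
    rw [← sum_add_distrib]
    exact sum_congr rfl fun b _ => by ring
  have eA : ∑ b : BIdx ι N, ∑ a : BIdx ι N, w a.1 * algD (bframe b) (algD (bframe a) u) Q ^ 2 =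
      ∑ a : BIdx ι N, ∑ b : BIdx ι N, w a.1 * algD (bframe b) (algD (bframe a) u) Q ^ 2 := sum_comm
  rw [Gam2W, show genL S (GamW w u u) Q = Lap (GamW w u u) Q + Gam S (GamW w u u) Q from rfl,
    Lap_GamW_self hN w hu, eC, eSwap, GamW_genL w hS hu, eB, eA]
  ring

/-! ### The Ricci term with weights -/

/-- **Weighted Ricci term**: `∑_{ab} w_a ([D_a,D_b]u)² = 2N Γ^w(u,u)` (cross-link commutators vanish;
each link contributes the Killing form of `𝔰𝔲(N)`, `Ric = N/2`). -/
theorem sum_sum_w_sq_comm_algD (hN : N ≠ 0) (w : ι → ℝ) {u : Cfg ι N → ℝ} (hu : ContDiff ℝ ∞ u)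
    (Q : Cfg ι N) :
    ∑ a : BIdx ι N, ∑ b : BIdx ι N, w a.1 *
        (algD (bframe a) (algD (bframe b) u) Q - algD (bframe b) (algD (bframe a) u) Q) ^ 2 =
      2 * N * GamW w u u Q := by
  have hW : ∀ a b : BIdx ι N, algD (bframe a) (algD (bframe b) u) Q - algD (bframe b) (algD (bframe a) u) Q =
      if a.1 = b.1 then linkFun u Q a.1 (frame a.2 * frame b.2 - frame b.2 * frame a.2) else 0 := by
    intro a b
    have h := congrFun (algD_comm hu (bframe a) (bframe b)) Q
    rw [Pi.sub_apply] at h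
    rw [h, bframe_comm]
    split_ifs with hab
    · rfl
    · simp [algD]
  simp_rw [hW]
  have hG : GamW w u u Q = ∑ e : ι, w e * ∑ α : FrameIdx N, linkFun u Q e (frame α) ^ 2 := by
    rw [GamW_self_eq_sum_sq, Fintype.sum_prod_type]
    refine sum_congr rfl fun e _ => ?_
    rw [mul_sum]
    rfl
  rw [hG, mul_sum, Fintype.sum_prod_type]
  refine sum_congr rfl fun e _ => ?_
  have hin : ∀ α : FrameIdx N, ∑ x : BIdx ι N, w ((e, α) : BIdx ι N).1 * (if ((e, α) : BIdx ι N).1 = x.1 then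
      linkFun u Q ((e, α) : BIdx ι N).1 (frame ((e, α) : BIdx ι N).2 * frame x.2 - frame x.2 * frame ((e, α) : BIdx ι N).2)
      else 0) ^ 2 = w e * ∑ β : FrameIdx N, linkFun u Q e (frame α * frame β - frame β * frame α) ^ 2 := by
    intro α
    rw [Fintype.sum_prod_type, Finset.sum_eq_single e]
    · rw [mul_sum]
      refine sum_congr rfl fun β _ => ?_
      have hee : ((e, α) : BIdx ι N).1 = ((e, β) : BIdx ι N).1 := rfl
      rw [if_pos hee]
    · intro e' _ he'
      refine sum_eq_zero fun β _ => ?_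
      have hne : ¬ ((e, α) : BIdx ι N).1 = ((e', β) : BIdx ι N).1 := fun h => he' h.symm
      rw [if_neg hne]
      ring
    · intro h; exact absurd (mem_univ _) h
  rw [sum_congr rfl fun α _ => hin α, ← mul_sum, sum_sum_sq_apply_comm_frame hN]
  ring

/-- **Weighted Ricci lower bound**: for nonnegative weights,
`(N/2) Γ^w(u,u) ≤ ∑_{a,b} w_a (D_bD_au)²`. -/
theorem ricci_GamW_le (hN : N ≠ 0) {w : ι → ℝ} (hw : ∀ e, 0 ≤ w e) {u : Cfg ι N → ℝ} (hu : ContDiff ℝ ∞ u)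
    (Q : Cfg ι N) :
    (N : ℝ) / 2 * GamW w u u Q ≤
      ∑ a : BIdx ι N, ∑ b : BIdx ι N, w a.1 * algD (bframe b) (algD (bframe a) u) Q ^ 2 := by
  set m : BIdx ι N → BIdx ι N → ℝ := fun a b => algD (bframe b) (algD (bframe a) u) Q with hm
  -- the commutator is supported on the diagonal blocks, where `w_a = w_b`
  have hdiag : ∀ a b : BIdx ι N, w a.1 * (m b a - m a b) ^ 2 =
      (if a.1 = b.1 then (1 : ℝ) else 0) * (w a.1 * (m b a - m a b) ^ 2) := by
    intro a b
    by_cases hab : a.1 = b.1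
    · rw [if_pos hab, one_mul]
    · rw [if_neg hab, zero_mul]
      have h := congrFun (algD_comm hu (bframe a) (bframe b)) Q
      rw [Pi.sub_apply, bframe_comm, if_neg hab] at h
      have h0 : algD (0 : Cfg ι N) u Q = 0 := by simp [algD]
      rw [h0] at h
      simp only [hm]
      rw [h]; ring
  have hcomm := sum_sum_w_sq_comm_algD hN w hu Q
  have hstep : ∑ a : BIdx ι N, ∑ b : BIdx ι N, w a.1 * (m b a - m a b) ^ 2 ≤
      4 * ∑ a : BIdx ι N, ∑ b : BIdx ι N, w a.1 * m a b ^ 2 := by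
    have hle : ∀ a b : BIdx ι N, w a.1 * (m b a - m a b) ^ 2 ≤
        (if a.1 = b.1 then (1 : ℝ) else 0) * (2 * (w a.1 * m a b ^ 2) + 2 * (w b.1 * m b a ^ 2)) := by
      intro a b
      rw [hdiag]
      by_cases hab : a.1 = b.1
      · rw [if_pos hab, one_mul, one_mul, ← hab]
        nlinarith [sq_nonneg (m a b + m b a), hw a.1]
      · rw [if_neg hab, zero_mul, zero_mul]
    calc ∑ a : BIdx ι N, ∑ b : BIdx ι N, w a.1 * (m b a - m a b) ^ 2
        ≤ ∑ a : BIdx ι N, ∑ b : BIdx ι N,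
            (if a.1 = b.1 then (1 : ℝ) else 0) * (2 * (w a.1 * m a b ^ 2) + 2 * (w b.1 * m b a ^ 2)) :=
          sum_le_sum fun a _ => sum_le_sum fun b _ => hle a b
      _ = 2 * ∑ a : BIdx ι N, ∑ b : BIdx ι N, (if a.1 = b.1 then (1 : ℝ) else 0) * (w a.1 * m a b ^ 2) +
          2 * ∑ a : BIdx ι N, ∑ b : BIdx ι N, (if a.1 = b.1 then (1 : ℝ) else 0) * (w b.1 * m b a ^ 2) := by
          rw [mul_sum, mul_sum, ← sum_add_distrib]
          refine sum_congr rfl fun a _ => ?_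
          rw [mul_sum, mul_sum, ← sum_add_distrib]
          exact sum_congr rfl fun b _ => by ring
      _ = 4 * ∑ a : BIdx ι N, ∑ b : BIdx ι N, (if a.1 = b.1 then (1 : ℝ) else 0) * (w a.1 * m a b ^ 2) := by
          rw [sum_comm (f := fun a b => (if a.1 = b.1 then (1 : ℝ) else 0) * (w b.1 * m b a ^ 2))]
          have : ∀ a b : BIdx ι N, (if b.1 = a.1 then (1 : ℝ) else 0) * (w a.1 * m a b ^ 2) =
              (if a.1 = b.1 then (1 : ℝ) else 0) * (w a.1 * m a b ^ 2) := by
            intro a b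
            by_cases hab : a.1 = b.1
            · rw [if_pos hab, if_pos hab.symm]
            · rw [if_neg hab, if_neg (Ne.symm hab)]
          simp_rw [this]
          ring
      _ ≤ 4 * ∑ a : BIdx ι N, ∑ b : BIdx ι N, w a.1 * m a b ^ 2 := by
          refine mul_le_mul_of_nonneg_left (sum_le_sum fun a _ => sum_le_sum fun b _ => ?_) (by norm_num)
          have h0 : 0 ≤ w a.1 * m a b ^ 2 := mul_nonneg (hw a.1) (sq_nonneg _)
          by_cases hab : a.1 = b.1
          · rw [if_pos hab, one_mul]
          · rw [if_neg hab, zero_mul]; exact h0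
  have hcomm' : ∑ a : BIdx ι N, ∑ b : BIdx ι N, w a.1 * (m b a - m a b) ^ 2 = 2 * N * GamW w u u Q := by
    rw [← hcomm]
  rw [hcomm'] at hstep
  simp only [hm] at hstep
  linarith

end Calculus

end SharpClustering

end Summit.Ventures.YMGap
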